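import Summits.BirchSwinnertonDyer.BirchSwinnertonDyer.Theses.ErratumRoadFive
import Literature.NumberTheory.EllipticCurves.Kato2004.AdmissibleZetaClassRealisability
import Literature.NumberTheory.EllipticCurves.MordellWeilTheoremProofs
import Literature.NumberTheory.EllipticCurves.TateModuleContinuityProofs
import Literature.NumberTheory.EllipticCurves.LeadingTerm
import Literature.NumberTheory.EllipticCurves.Rank1Residual.Typed.Basic
import HarnessLib

/-!
# Line `kato_Fframe` — STAGE 1 skeleton of the door «kato-bottom-layer-exczero» on
# `ErratumRoadFive.EulerHalfNotRamNoInertSetAtFive` (stmt-BirchSwinnertonDyer-19715) — rev 4 CANDIDATE (Λ-TAM)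

DRAFT TURNKEY (planner-bsd-idea-9 g39, lens = complete). rev 2 (c6ad67b45cb26edf) stands at `Lines/kato_Fframe.lean`,
rev 3.1 (a2d17d87f6602fc8, critic V265/V269 PASS, GATE B option (a″)) at `Lines/kato_Fframe_r3.lean`; THIS file is the
rev-4 CANDIDATE at a THIRD path (`Lines/kato_Fframe_r4.lean`) so that the objects priced for GATE B are untouched — a
drop-in replacement (same namespace, same composition name `EulerHalfNotRamNoInertSetAtFive_of`) that the route pen /
LEAD may key INSTEAD of rev 3.1, at GATE B or later. Published by `ledger crux write` ONLY; NOT registered (W-79: the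
line of record on 19715 stays `Lines/birth.lean` v17 until the pen decides otherwise). Nothing here is a route item;
no summit statement, crux or stub is proved by this file; BSD is proved for no curve. Crux idea card of the lever:
`Ideas/lambda-tamagawa-recovery.md`; line card `Lines/kato_Fframe_r4.md`.

## What rev 4 changes (one lever, two consequences)

rev 3.1 left TWO things outside the door: (J2) the print-open stub S1♯′ — the Kolyvagin-system defect as a SUM over
the places carrying `p` in `∏_{ℓ≠p} c_ℓ · #E(ℚ_p)[p^∞]` (Büyükboduk's Question 2; catalogued barrier
`StringentKolyvaginCapsAtMax` bites head-on: local-condition refinements of `KS(T_pE, F_can)` over `ℚ` give the MAXIMUM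
over places, never the sum) — and (J1) the honest residual S4′ = the crux at a NON-SPLIT multiplicative `p` (34 of the
404 census pairs). rev 4's lever removes the first and reduces the second to a Perrin-Riou VALUE statement:

LEMMA Λ-TAM («Tamagawa recovery by Λ-adic divisibility descended through the FINE Selmer group at `T = 0`»; ours,
print-assembled — the three inputs are printed theorems, the assembled statement is not in print; nearest print =
Wuthrich's leading-term formula for the fine Selmer group, J. Algebraic Geom. 16 (2007), at POTENTIALLY GOOD `p`).
Setting: `p ≥ 5`, `ρ̄_{E,p}` onto (so `ρ_{E,p}` onto, Serre), `r_an = 1` (so rank 1, `Ш[p^∞]` finite, GZK), `p`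
multiplicative (split OR non-split), `Σ = {p, ∞} ∪ {ℓ ∣ N}`, `T = T_pE`, `A = E[p^∞]`, `Λ = ℤ_p[[Γ]]`, `Γ = Gal(ℚ_∞/ℚ)`.
(A) `H := H¹(G_Σ,T) = H¹_f(ℚ,T) = ℤ_p·x̂` (`x̂` a Mordell–Weil generator: `H_tors = E(ℚ)[p^∞] = 0`; `H²(G_Σ,V) ≅ Ш¹(G_Σ,V)^*
= 0` because `Ш¹(V) ⊂ ℚ_p x̂` and `loc_p x̂ ≠ 0`; `H/H¹_f ↪ H¹(ℚ_p,T)/H¹_f` torsion-free and `H¹(ℚ_ℓ,V) = 0` at `ℓ ∥ N`).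
`M := H¹_Iw(G_Σ,T)` (`=` Kato's `𝐇¹` in the Γ-direction: the punctual terms `⊕_{w∣ℓ} H¹(I_ℓ,T)^{Frob_w} ≅ ℤ/c_ℓ^{(p)}`
die in `lim←` under `cores = ×p`) is Λ-FREE OF RANK ONE (Kato Thm. 12.4 (3): `p ≠ 2`, `E[p]` irreducible); the
descent sequence `0 → M/TM → H → H²_Iw(G_Σ,T)[T] → 0` (cohomology of `0 → T⊗Λ →(γ−1) T⊗Λ → T → 0`, `cd_p G_Σ = 2`) makes
`N := im(M → H) = p^a ℤ_p x̂` (the global universal norms; `a < ∞` for free). Write the admissible class as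
`z^Λ = g̃·w̄` (`w̄` a Λ-basis of `M`, `g̃ ∈ Λ`); its bottom layer is `z₁ = g̃(0)·p^a·u·x̂`, so
`ind_H(z₁) = ord_p g̃(0) + a = ord_p t − ord_p log_ω(x̂)` (`t = log_ω loc_p z₁`; `loc_p ∘ log_ω` is injective on `H`).
(B) DIVISIBILITY. `Y := Sel₀(E/ℚ_∞)[p^∞]^∨ = ker(H²_Iw(G_Σ,T) → ⊕_{v∈Σ_f} H²_Iw(ℚ_v,T))` (Poitou–Tate) embeds in Kato's
`𝐇²_Γ` with cokernel inside `(E(ℚ_{p,∞})[p^∞])^∨` (tree `Kato2004/IwasawaH2FineSelmerDualComparison.lean`; Kurihara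
2002 / Kobayashi 2003 `0 → X₀ → 𝐇² → 𝐇²_loc`); Kato Thm. 12.5 (4) [Astérisque 295 p. 222] under (12.5.2) (⇐ `ρ̄` onto,
`p ≥ 5`): `length_𝔭 𝐇²_𝔭 ≤ length_𝔭 (𝐇¹/Z(f,T))_𝔭 ≤ length_𝔭 (M/Λz^Λ)_𝔭` at every height-one `𝔭` of `ℤ_p[[Γ]]` «unless
(12.5.1)» — and the (12.5.1) exception cannot occur in the Γ-component: there `𝐇²_loc = (E(ℚ_{p,∞})[p^∞])^∨` is
FINITE (`μ_p ⊄ ℚ_{p,∞}`; split `p`: `E(ℚ_{p,∞})[p^∞] = E(ℚ_p)[p^∞]`, r3.1 header; non-split `p ≥ 5`: `= 0`), i.e.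
pseudo-null, while (12.5.1) requires `length_𝔭 𝐇²_loc,𝔭 = 1` (the Tate-period prime `𝔭` lives in a `Δ`-component
with `χ∣_Δ = ω⁻¹ ≠ 1`). Hence `char_Λ Y ∣ (g̃)` and, `Y_Γ` being finite ((C) below), `f_Y(0) ≠ 0` and
`ord_p f_Y(0) = len Y_Γ − len Y^Γ ≤ ord_p g̃(0) = ind_H(z₁) − a`. No main conjecture, no `p`-adic `L`-function, no
`μ = 0` is used — one divisibility, at the bottom prime `(T)` only.
(C) CONTROL for the FINE Selmer group in rank one (Greenberg's diagram with the strict condition at every `v ∈ Σ_f`;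
`E(ℚ_∞)[p^∞] = 0`, `cd Γ = 1`): `Sel₀(ℚ,A) ↪ Sel₀(ℚ_∞,A)^Γ` with cokernel `im(loc) ∩ ⊕_v K_v`, `K_v := ker(H¹(ℚ_v,A) →
H¹(ℚ_{∞,w},A)) = H¹(Γ_v, E(ℚ_{v,∞})[p^∞])`; `im(loc) = loc(H)^⊥` (Poitou–Tate, `H¹(ℝ,A) = 0`) and `K_v^⊥ = N_v :=
im(H¹_Iw(ℚ_v,T) → H¹(ℚ_v,T))` (res/cor adjoint under Tate local duality), so with `H = ℤ_p x̂` CYCLIC: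
`#coker = ∏_v #K_v / p^{max_v e_v}`, `e_v :=` exponent of `loc_v x̂` in `H¹(ℚ_v,T)/N_v`. Orders: `#K_ℓ = c_ℓ^{(p)}` for
`ℓ ≠ p` (Greenberg, LNM 1716, Lemma 3.3 and p. 88: «`= c_v^{(p)}` for all `n`» at split multiplicative `ℓ`, `1` at
non-split `ℓ` (`p` odd) and at additive `ℓ` (`p ≥ 5`) — `= c_ℓ^{(p)}` in every case; the fine local condition at
`ℓ ≠ p` IS Greenberg's `ℋ_E(ℚ_ℓ) = H¹(ℚ_ℓ,A)`); `#K_p = #H¹(Γ_p, E(ℚ_{p,∞})[p^∞]) = #E(ℚ_p)[p^∞] =: p^m` at split `p`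
(finite module with trivial `Γ_p`-action) and `= 1` at non-split `p ≥ 5` — Wuthrich's `Tors_{ℤ_p} D_{E,p}`, Ray–Sujatha's
«local torsion» (NOT Greenberg's Selmer kernel `∼ log_p(q_E)/2p` at split `p`, which belongs to the `im κ` condition
and does not enter). So `len Y_Γ = len Sel₀(ℚ,A) + Σ_{ℓ≠p} ord_p c_ℓ + m − max_v e_v`; and `Y^Γ = Y[T] =
ker(H/N → ⊕_v H¹(ℚ_v,T)/N_v) = H_ln/N`, `H_ln = p^{max e} ℤ_p x̂ ⊇ N` (global norms are local norms), `len Y^Γ = a − max e`.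
(D) Subtract: the unknown indices `a` and `max e` CANCEL —
`len Sel₀(ℚ,E[p^∞]) + Σ_{ℓ≠p} ord_p c_ℓ + ord_p #E(ℚ_p)[p^∞]·[p split] ≤ ind_H(z₁) = ord_p t − ord_p log_ω(x̂)`, and
`len Sel₀(ℚ,A) = ord_p #Ш + (ord_p log_ω(x̂) − min_Q ord_p log_ω(Q))` (`0 → (ℚ_p/ℤ_p)x̂ ∩ ker → Sel₀(ℚ,A) → Ж = Ш[p^∞] → 0`
in rank `> 0`, Wuthrich; the first term is the cokernel-torsion `D_{E,p}` count). This is EXACTLY the shape of rev 3's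
S1♯′ with the booked defect `d = (ord_p ∏c_ℓ − ord_p c_p) + m` — now a LEMMA at every multiplicative `p ≥ 5`, split or
not, with no Kolyvagin-system refinement at all: the Tamagawa SUM comes from the control theorem (where local kernels
MULTIPLY), the Kato input is spent once, Λ-adically, where there are no Tamagawa defects to lose. Equivalently
`∂^{(∞)}(κ^{Kato}) ≥ Σ_{ℓ≠p} ord_p c_ℓ + m` — the «≥» direction of Büyükboduk's Question 2 for Kato's system at
`r_an = 1`, `p ∥ N`, `p ≥ 5`, `ρ̄` onto (Kim 2025 §3: the arithmetic meaning of `∂^{(∞)}` «should [be] reveal[ed]» — open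
in print; BCGS 2023 extract Tamagawa numbers from the FULL main conjecture at good `p`). BSD-CONSISTENCY: Λ-TAM is
predicted with EQUALITY at the minimising `Q` in every regime checked — rank 0 good `p` (`e_s = len Ш/Ж` by
Poitou–Tate), rank 1 good `p` (`−v_min + m = ord_p(#Ẽ(𝔽_p)/p)`), rank 1 non-split `p` (`v_min = 1`, `ord_p(1 + 1/p) =
−1`), rank 1 split `p` (the door chain) — no slack anywhere, the usual signature of correct bookkeeping.

CONSEQUENCES FOR THE SKELETON (6 stubs; k unchanged). S1♭ and S1♯′ MERGE into S1Λ
(`stub_katoLambdaLogBoundTamagawa`: hypothesis `p` multiplicative; defect `(ord_p ∏c_ℓ − ord_p c_p) + m` with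
`c_p := (W.baseChange ℚ_[p]).localTamagawaNumber ℤ_[p]`, the tree's local Tamagawa number); S2′ becomes S2″
(`stub_tateUniformisationLogMinimumTamagawa` = S2′ ∧ «`c_p = ord_p Δ_min`» at split `p`, Tate's algorithm Step 2 —
the identity rev 3 carried as the HYPOTHESIS `hcc` of its door branch is now a provable conjunct); NEW S2ns
(`stub_nonsplitLogMinimum`: at non-split multiplicative `p ≥ 5`, `p ∤ c_p ∈ {1,2}` and a local point with
`ord_p log_ω = 1` — `E(ℚ_p) ⊗ ℤ_p = E₁(ℚ_p) ≅ pℤ_p` by the formal logarithm, `p ∤ c_p·#Ẽ_ns(𝔽_p) = c_p(p+1)`); S3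
unchanged (the door, split `p`); NEW S3ns (`stub_integralNonsplitValue`: the rank-one Perrin-Riou value at a NON-split
multiplicative prime, one-sided integral form, `−1 = ord_p(1 − a_p/p)² /… = ord_p((1 + 1/p)·(unit))` — PRINT-OPEN, see
its docstring) REPLACES the residual S4′. Composition: split `p` → S2″ ∧ S3 ∧ S1Λ → `sha_le_of_doorTwoGraded` with
`c := ord_p c_p` (ONE branch for door + J3 + J2: no case split on `ord_p ∏c_ℓ = ord_p c_p` any more); non-split `p` →
S2ns ∧ S3ns ∧ S1Λ(`m := 0`, `Q₀ := 0`) → `sha_le_of_nonsplitChain`. COVERAGE of the 404 `ρ̄`-onto census pairs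
(`bsd-stepL/shim/notram_census_j254667.tsv`): 370 split (door 287 + J3 47 + J2 36) through S1Λ ∧ S2″ ∧ S3 — NO
print-open input left besides S3's integral form (S1Λ is a LEMMA with a written proof, S2″ is Tate-curve routine);
34 non-split (27 at `p = 5`, 7 at `p = 7`; smallest 8670u1@5) through S1Λ ∧ S2ns ∧ S3ns — one print-open input, S3ns.
RESIDUAL STUB: none. What is NOT claimed: S3 (research, XL, as rev 2/3) and S3ns (print-open) are values of Kato's
element — the analytic side; everything on the algebraic side of the door is now print or LEMMA.

PRINT vs LEMMA layers of S1Λ (honesty, critic W2 format). PRINT: Kato Thm. 12.4 (3) and 12.5 (4) [Kato2004Asterisque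
pp. 221–222]; the comparison `X₀ ↪ 𝐇²` [Kurihara2002 §; tree file above]; Greenberg's local kernels [GreenbergLNM1716
Lemma 3.3, p. 88; Lemma 3.4]; Poitou–Tate and Tate local duality [Nekovar2006 / Milne ADT]; `Ж = Ш[p^∞]` in positive
rank and the fine leading-term formalism [Wuthrich2007JAG; RaySujatha2021 Thm. 2.5–2.6]. LEMMA (ours): the assembly
(A)–(D), in particular (i) `𝐇¹_Γ = H¹_Iw(G_Σ,T)` (punctual terms die), (ii) the (12.5.1)-exclusion in the Γ-component
at multiplicative `p` (finiteness of `E(ℚ_{p,∞})[p^∞]`), (iii) the cancellation of `a` and `max e`. REMARK level in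
print: rev 3.1's D_p (`∂^{(∞)} ≥ m`) is the `Σ' = 0` case of (D) and is superseded (its KS̄/germ apparatus is no
longer needed; it remains a second proof of the `m`-part).

BARRIER PLACEMENT (catalogue `Literature/Barriers/BirchSwinnertonDyer/`). `StringentKolyvaginCapsAtMax`: EVADED, not
beaten — Λ-TAM is not a local-condition refinement of a Kolyvagin system over `ℚ` (the barrier's technique class); it
is the barrier's own named evasion (i) «an Iwasawa-theoretic / control input» — here Kato's Λ-adic divisibility
12.5 (4) for the FINE Selmer group plus the control theorem, in which local kernels multiply (`∏_v #K_v`), which is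
where the SUM comes from; no IMC equality is used (BCGS need the full IMC only to get EQUALITY; the Euler HALF needs
`⊆`). `ExceptionalZero`: outside — no `p`-adic `L`-function, no `𝓛`-invariant; the fine (= strict) side, where the
trivial-zero phenomenon shows up only as the finite local term `K_p` of order `#E(ℚ_p)[p^∞]` and is booked.
`PAdicHeightNondegeneracy`: outside — no height, no regulator: in rank one the fine complex has `Y^Γ = H_ln/N` and the
would-be regulator is replaced by the INDEX identity `ind_H(z₁) = ord_p g̃(0) + a`, whose unknown `a` cancels. (The
Selmer-side Λ-adic route — Kato 17.4 with `L_p` and the Selmer dual — would need `h_p(x̂) ≠ 0` at non-split `p` and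
the `𝓛`-invariant at split `p`; that is exactly why the line stays on the fine side.)

## The line in one paragraph (rev 4)

For `(E, p)` in the target class (X11b, `p ≥ 5`, `ρ̄_{E,p}` onto, no (ram) prime, `p ∣ ∏ c_ℓ`, no inert-set datum)
the Euler half `ord_p #Ш ≤ ord_p #Ш_an` is read off the BOTTOM LAYER of Kato's `Ω_E`-normalised Λ-adic zeta element —
the tree's ADMISSIBLE class `z₀` (`Kato2004.IsAdmissibleZetaClass`, realisable at `p ≥ 5`, `ρ̄` onto, by the tree's
named fact `exists_isAdmissibleZetaClass_of_imageContainsSL2` = Kato Thm. 12.5 (4)) — through its KUMMER LOGARITHM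
`t = log_ω(loc_p z_ℚ)` (`Kato2004.HasLocPKummerLog`, tree currency, no `B_dR`), NOT through a `p`-adic height:

* `stub_katoLambdaLogBoundTamagawa` S1Λ (LEMMA Λ-TAM, XL; `p` multiplicative, either sign):
  `ord_p #Ш + ord_p log_ω(x̂) − ord_p log_ω(Q) + (ord_p ∏c_ℓ − ord_p c_p) + m ≤ ord_p t − ord_p log_ω(x̂)` for every
  local point `Q` with `log_ω(Q) ≠ 0` and every `m` with a point of order `p^m` in `E(ℚ_p)`.
* `stub_tateUniformisationLogMinimumTamagawa` S2″ (PROVABLE, M–L, Tate curve): `c_p = ord_p Δ_min` and some `m`, a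
  point `Q₀` of order `p^m`, a point `Q` with `log_ω(Q) ≠ 0`, `ord_p log_ω(Q) = 1 − ord_p c_p + m`.
* `stub_nonsplitLogMinimum` S2ns (PROVABLE, M): at non-split `p ≥ 5`, `ord_p c_p = 0` and a point with `ord_p log_ω = 1`.
* `stub_integralExcZeroValue` S3 = THE TRANSFER STATEMENT C⁺ at split `p` (research, XL; the door; verbatim rev 2/3).
* `stub_integralNonsplitValue` S3ns = C⁺ at NON-split `p` (PRINT-OPEN, XL): same shape, `−1 = ord_p` of the Euler-type
  factor `(1 + 1/p)`-class constant of Perrin-Riou's formula at a non-split multiplicative prime.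
* `stub_printedFactsHeld` S0 (CITE): GZK ∧ Kato Thm. 12.5 (4) realisability (tree named facts).

Composition `EulerHalfNotRamNoInertSetAtFive_of` (kernel-checked, no sorry): GZK gives rank one and a generator
(`exists_isMordellWeilBasis_holds`), Kato 12.5 (4) an admissible class (`exists_datum_of_hasSurjectiveModNGaloisRep`);
on `p` split, S3 gives `(q,t)`, S2″ gives `c_p = ord_p Δ_min` and `(m, Q₀, Q)`, S1Λ the bound, `sha_le_of_doorTwoGraded`;
on `p` non-split (multiplicative by X11b), S3ns gives `(q,t)`, S2ns gives `ord_p c_p = 0` and `Q`, S1Λ at `m = 0`,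
`Q₀ = 0` the bound, `sha_le_of_nonsplitChain`. BSD-tight in both branches, consistent only because
`ord_p #E(ℚ)_tors = 0` (automatic: `ρ̄` onto, `p ≥ 5`) — W1 of rev 2 stands. The crux hypotheses `¬Ram`, `p ∣ ∏c_ℓ`
and the inert-set clause are NOT used by the composition (as in rev 2/3: the line proves the Euler half on the whole
of X11b ∩ {p ≥ 5, ρ̄ onto} modulo its stubs; no stub is thereby stronger than print allows — S3/S3ns are one-sided
VALUE statements, S1Λ a LEMMA with proof (A)–(D)).

KS-IMPRIMITIVITY LEDGER (card §J of `Lines/kato_Fframe.md`): BSD predicts `∂^{(∞)}(κ^{Kato}) = Σ_{ℓ≠p} ord_p c_ℓ + m`;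
rev 3 proved the `m` part (D_p), rev 4 proves the whole «≥» (Λ-TAM (D)); «≤» is not needed for the Euler half.
Why no posited integer interface: as rev 2 (junk-false / non-composing; the waist is tree vocabulary).

Disproof ledger honoured: none of the stubs is an instance of a landed Negative lemma of this crux
(`ledger negatives --problem BirchSwinnertonDyer`: no statement about `HasLocPKummerLog` / admissible classes /
`MissingUpperBoundAt` / `localTamagawaNumber` at a multiplicative prime is refuted); no stub carries the crux's
conclusion `MissingUpperBoundAt` (rev 3's S4′ did — it is gone); no stub implies the crux or the route leaf cheaply
(probe table in the card); S2″/S2ns are numerically checkable on the census (Tate's algorithm), S1Λ/S3/S3ns are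
BSD-predicted (equality) on all 404 pairs.
-/

noncomputable section

open scoped Classical

set_option linter.dupNamespace false

namespace Summit.BirchSwinnertonDyer.BirchSwinnertonDyer.Cruxes.EulerHalfNotRamNoInertSetAtFive.KatoFframe

open Field
open Literature.NumberTheory.GaloisRepresentations
open Literature.NumberTheory.EllipticCurves Literature.NumberTheory.EllipticCurves.Kato2004
open Literature.NumberTheory.EllipticCurves.Kato2004.EulerSystemValues
open Literature.NumberTheory.EllipticCurves.Rank1Residual
open Literature.NumberTheory.EllipticCurves.Rank1Residual.Typed
open Summit.BirchSwinnertonDyer.Rank1Residual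
open Summit.BirchSwinnertonDyer.BirchSwinnertonDyer.Theses.ErratumRoadFive

/-! ## §0 Vocabulary (definitions with bodies; nothing asserted) -/

/-- `E(ℚ) → E(ℚ_p)` on points (Mathlib's `Point.map` along `ℚ → ℚ_p`; same body as the tree's
`WeierstrassCurve.toPadicPoint`). [folklore] -/
abbrev toLocalPoint (W : WeierstrassCurve ℚ) (p : ℕ) [Fact p.Prime] :
    W.toAffine.Point →+ (W.baseChange ℚ_[p]).toAffine.Point :=
  WeierstrassCurve.Affine.Point.map (W' := W.toAffine) (S := ℚ) (Algebra.ofId ℚ ℚ_[p])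

/-- `log_ω(x) ∈ ℚ_p` of a RATIONAL point `x ∈ E(ℚ)` (Néron differential, `W` globally minimal):
`padicLogLocal` of its image in `E(ℚ_p)`. [cite: SilvermanAEC2009, IV.6.4 and VII.2.2] -/
def logOmega (W : WeierstrassCurve ℚ) [W.IsElliptic] [W.IsGloballyMinimal] (p : ℕ) [Fact p.Prime]
    (x : W.toAffine.Point) : ℚ_[p] :=
  padicLogLocal W p (toLocalPoint W p x)

/-- The BOTTOM LAYER `z_ℚ ∈ H¹(ℚ, T_pE)` of a class `z₀` of a pinned Iwasawa cohomology
`I : IwasawaH1Data W p K γ` (`I.proj 0`, moved to `⊤` by `layerZeroToTop`).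
[cite: Kato2004Asterisque, §12.2 (p. 220) and §14.14 (14.14.1) (p. 243)] -/
def bottomClass (W : WeierstrassCurve ℚ) [W.IsElliptic] (p : ℕ) [Fact p.Prime]
    [ContinuousSMul ℤ_[p] (W.tateModule p)] (K : ZpExtension ℚ p) {γ : absoluteGaloisGroup ℚ}
    (I : IwasawaH1Data W p K γ) (z₀ : I.H) : H1 (tateRep W p) ⊤ :=
  layerZeroToTop W p K (I.proj 0 z₀)


/-! The regimes are stated INLINE in the stub signatures (rev 2 hygiene kept: no `def … : Prop` in a crux
workfile): «`W.HasMultiplicativeReductionAtPrime p`» / «`W.HasSplitMultiplicativeReductionAtPrime p`» / its negation;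
the local Tamagawa number at `p` is the tree's «`(W.baseChange ℚ_[p]).localTamagawaNumber ℤ_[p]`» (index of the
good-reduction subgroup of the minimal model; `= ord_p Δ_min` at split `p`, `∈ {1,2}` at non-split `p` — Tate's
algorithm, carried by S2″ / S2ns as provable conjuncts, NOT as hypotheses); «`addOrderOf Q₀ = p ^ m`» (a local point of
order `p^m`, so `p^m ∣ #E(ℚ_p)[p^∞]`; rev 3's graded datum). -/

/-! ## §1 The registered-shape stubs (k = 6; sorries ONLY here) -/

/-- **S0 (CITE) printed facts held as tree named facts**: Gross–Zagier–Kolyvagin («`r_an ≤ 1 ⇒ rank =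
r_an ∧ Ш finite`») and Kato Thm. 12.5 (4) realisability of an admissible zeta class in every pinned
`𝐇¹_Γ(T_pE)` under (12.5.2). Closed at route level by `(h : Fact)` binders, never by a proof here.
[cite: Kato2004Asterisque, Thm. 12.5 (4) with (12.5.2) (p. 222)] [cite: Darmon2004, Thm. 3.22] -/
theorem stub_printedFactsHeld :
    rank_eq_analyticRank_of_analyticRank_le_one ∧ exists_isAdmissibleZetaClass_of_imageContainsSL2 := by
  sorry

/-- **S1Λ (LEMMA Λ-TAM, XL; new in rev 4, SUPERSEDES S1♭ AND S1♯′) Kato's Λ-adic divisibility descended through the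
fine Selmer group: the logarithmic Kolyvagin-type bound WITH THE WHOLE TAMAGAWA DEFECT BOOKED.** For `p ≥ 5`,
`ρ̄_{E,p}` onto, `r_an(E) = 1`, `p` MULTIPLICATIVE (split or non-split), a Mordell–Weil generator `x̂ = P 0`, an
admissible Kato class `z₀` with bottom Kummer logarithm `t ≠ 0`, ANY `m` such that `E(ℚ_p)` has a point `Q₀` of order
`p^m`, and ANY local point `Q` with `log_ω(Q) ≠ 0`:
`ord_p #Ш + ord_p log_ω(x̂) − ord_p log_ω(Q) + (ord_p ∏_ℓ c_ℓ − ord_p c_p) + m ≤ ord_p t − ord_p log_ω(x̂)`,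
`c_p = (W.baseChange ℚ_[p]).localTamagawaNumber ℤ_[p]`. Proof = header (A)–(D): (A) `H¹(G_Σ,T_pE) = ℤ_p x̂`,
`𝐇¹_Γ = H¹_Iw(G_Σ,T)` free of rank one (Kato 12.4 (3)), `ind(z₁) = ord_p g̃(0) + a`; (B) `char_Λ X₀(E/ℚ_∞) ∣ (g̃)` from
Kato 12.5 (4) + the tree comparison `X₀ ↪ 𝐇²_Γ` (finite cokernel), the (12.5.1) prime being absent from the
Γ-component because `E(ℚ_{p,∞})[p^∞]` is finite at multiplicative `p`; (C) control for the fine Selmer group in rank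
one: `len X₀,Γ = len Sel₀(ℚ) + Σ_{ℓ≠p} ord_p c_ℓ + ord_p #E(ℚ_p)[p^∞] − max e` (Greenberg Lemma 3.3 / p. 88 at `ℓ ≠ p`;
`K_p = H¹(Γ_p, E(ℚ_{p,∞})[p^∞])` at `p`; Poitou–Tate for the cokernel with `H` cyclic) and `len X₀^Γ = a − max e`;
(D) subtraction — `a`, `max e` cancel — and `len Sel₀(ℚ,E[p^∞]) = ord_p #Ш + ord_p log_ω(x̂) − min ord_p log_ω`
(`Ж = Ш[p^∞]` in positive rank). The inequality only sharpens as `m` grows to `ord_p #E(ℚ_p)[p^∞]` and as `ord_p log_ω(Q)`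
drops to its minimum, so the ∀-form over `(m, Q₀, Q)` is implied by the extremal instance. HONESTY LAYER: PRINT =
Kato 12.4 (3) / 12.5 (4), the `X₀ ↪ 𝐇²` comparison (Kurihara / Kobayashi; tree file), Greenberg's local kernels,
Poitou–Tate / Tate duality, Wuthrich's `Ж = Ш[p^∞]`; LEMMA (ours) = the assembly, items (i)–(iii) of the header.
NEAREST PRINT: Wuthrich's fine leading-term formula `a_r ∼ Reg·#Tors D·∏_{ℓ≠p} c_ℓ·#Ж/#J` (J. Algebraic Geom. 2007;
Ray–Sujatha Thm. 2.6) — at POTENTIALLY GOOD `p`; its numerator is exactly `len X₀,Γ + max e` of (C). BSD predicts S1Λ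
with EQUALITY at the minimising `Q` (door, J2, J3, non-split: checked in the header). Why it might fail: (i) a slip in
the LEMMA layer — the (12.5.1)-exclusion (if Kato's exceptional `𝔭` met the Γ-component at `(T)` the bound (B) would
be off by ONE at `T = 0`; the finiteness of `E(ℚ_{p,∞})[p^∞]` for odd `p` is what excludes it) or the identification
`𝐇^q_{Kato} ↔ H^q_Iw(G_Σ,T)` in degree 2 (only `X₀ ↪ 𝐇²`, finite cokernel, is used — tree comparison file); (ii) as
S1/S1♭: the `ℤ_pˣ`-identification of the admissible bottom layer `z₁` with the class whose Λ-adic lift generates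
`Λ z^Λ ⊂ Z(f,T)` after Kato's multiplier is divided out (12.5 (4) bounds by `𝐇¹/Z(f,T)`, a QUOTIENT of `𝐇¹/Λz^Λ` —
right direction). Serves: door (287), J3 (47), J2 (36) at split `p` and J1 (34) at non-split `p` — all 404 pairs.
[cite: Kato2004Asterisque, Thm. 12.4 (3) (p. 221) and Thm. 12.5 (4) with (12.5.1)–(12.5.2) (p. 222)]
[cite: GreenbergLNM1716, Lemma 3.3 and p. 88, Lemma 3.4] [cite: Kurihara2002, §1] [cite: Wuthrich2007JAG, Thm. 1.1]
[cite: RaySujatha2021, Thm. 2.5 and Thm. 2.6] [cite: Nekovar2006, §0 (Poitou–Tate)] [cite: Kim2025RefinedTNC, §3.5]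
[cite: Buyukboduk2009TamagawaDefect, §4.2 Question 2 (arXiv:0710.3858 p. 12)] -/
theorem stub_katoLambdaLogBoundTamagawa :
    ∀ (W : WeierstrassCurve ℚ) [W.IsElliptic] [W.IsGloballyMinimal] (p : ℕ) [Fact p.Prime]
      [ContinuousSMul ℤ_[p] (W.tateModule p)],
      5 ≤ p → Surj W p → W.analyticRank = 1 → W.HasMultiplicativeReductionAtPrime p →
      ∀ (h1 : W.mordellWeilRank = 1) (P : Fin W.mordellWeilRank → W.toAffine.Point),
        W.IsMordellWeilBasis P →
      ∀ (K : ZpExtension ℚ p) (hK : K.IsCyclotomic) (γ : absoluteGaloisGroup ℚ)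
        (I : IwasawaH1Data W p K γ) (z₀ : I.H), K.IsTopGenerator γ → IsAdmissibleZetaClass W p K hK I z₀ →
      ∀ t : ℚ_[p], HasLocPKummerLog W p (bottomClass W p K I z₀) t → t ≠ 0 →
      ∀ (m : ℕ) (Q₀ : (W.baseChange ℚ_[p]).toAffine.Point), addOrderOf Q₀ = p ^ m →
      ∀ Q : (W.baseChange ℚ_[p]).toAffine.Point, padicLogLocal W p Q ≠ 0 →
        (padicValNat p W.shaOrder : ℤ) + (logOmega W p (P (Fin.cast h1.symm 0))).valuation
            - (padicLogLocal W p Q).valuation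
            + (((padicValNat p W.tamagawaProduct : ℤ)
                - padicValNat p ((W.baseChange ℚ_[p]).localTamagawaNumber ℤ_[p])) + m) ≤
          t.valuation - (logOmega W p (P (Fin.cast h1.symm 0))).valuation := by
  sorry

/-- **S2″ (PROVABLE, M–L; rev 3's S2′ ∧ the split Tamagawa identity) Tate-uniformisation log MINIMUM with
`c_p = ord_p Δ_min`.** At a split multiplicative prime `p ≥ 5`: the local Tamagawa number of the tree
(`(W.baseChange ℚ_[p]).localTamagawaNumber ℤ_[p]` = index of the good-reduction subgroup of the minimal model) equals
`ord_p Δ_min` (Tate's algorithm Step 2: split type `I_n`, `Φ(𝔽_p) ≅ ℤ/n`, `n = ord_p Δ_min = ord_p q_E`; `W` globally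
minimal so `W.baseChange ℚ_[p]` is minimal at `p`), AND there are `m : ℕ`, a local point `Q₀` of order EXACTLY `p^m`
and a local point `Q` with `log_ω(Q) ≠ 0` and `ord_p log_ω(Q) = 1 − ord_p(c_p) + m` — witnesses exactly as rev 3's
S2′ (`E(ℚ_p) ≅ ℚ_pˣ/q^ℤ`, `q = p^e u`, `e = c_p`, `s := ord_p log_p(u) − 1`, `m := min(ord_p e, s) = ord_p #E(ℚ_p)[p^∞]`,
`Q₀ := Φ_Tate(q^{1/p^m})`, `Q := Φ_Tate(p)` if `s < ord_p e`, `Q := Φ_Tate(1 + p)` otherwise). rev 3 carried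
`ord_p ∏c_ℓ = ord_p(ord_p Δ_min)` as the HYPOTHESIS `hcc` of its door branch; rev 4 needs the identity itself because
S1Λ speaks of `c_p`, and files it here, where it is provable. Why it might fail: only through the normalisation of
`padicLogLocal` (as S2′) or through the tree's `localTamagawaNumber` being the index in `W(ℚ_p)` of the good-reduction
subgroup of `W.minimal ℤ_[p]` rather than of `W` itself (they agree: `W` is globally minimal; cf. the tree's bridge
Prop `localTamagawaNumber_padic_eq` and `localTamagawaNumber_of_hasNonsplitMultiplicativeReductionAt_holds` for the
place-indexed normal form). Leans on: tree `SteinWuthrich2013/SplitUniformizationData*`, `padicLogPoint`,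
`Tamagawa.lean` (`localTamagawaNumber`, `goodReductionSubgroup`), `KodairaSymbol`/Tate's algorithm files.
[cite: SilvermanATAEC1994, IV.9.4 (Tate's algorithm, Step 2), V.3.1, V.4.1 and V.5.3] [cite: SilvermanAEC2009, IV.6.4 (b)]
[cite: Kim2022StructureSelmer, Prop. 3.1] -/
theorem stub_tateUniformisationLogMinimumTamagawa :
    ∀ (W : WeierstrassCurve ℚ) [W.IsElliptic] [W.IsGloballyMinimal] (p : ℕ) [Fact p.Prime],
      5 ≤ p → W.HasSplitMultiplicativeReductionAtPrime p →
      (W.baseChange ℚ_[p]).localTamagawaNumber ℤ_[p] = padicValInt p W.minimalDiscriminantInt ∧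
      ∃ (m : ℕ) (Q₀ Q : (W.baseChange ℚ_[p]).toAffine.Point), addOrderOf Q₀ = p ^ m ∧
        padicLogLocal W p Q ≠ 0 ∧
        (padicLogLocal W p Q).valuation =
          1 - (padicValNat p (padicValInt p W.minimalDiscriminantInt) : ℤ) + m := by
  sorry

/-- **S2ns (PROVABLE, M; new in rev 4) the local minimum at a NON-SPLIT multiplicative prime.** At a non-split
multiplicative prime `p ≥ 5`: `p ∤ c_p` (Tate's algorithm: non-split `I_n` has `c_p ∈ {1,2}`; tree
`localTamagawaNumber_of_hasNonsplitMultiplicativeReductionAt_holds`, `localTamagawaNumber_dvd_two_of_nonsplit`), and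
there is a local point `Q` with `log_ω(Q) ≠ 0` and `ord_p log_ω(Q) = 1`: `#Ẽ_ns(𝔽_p) = p + 1` and `c_p ∣ 2` are prime to
`p`, so `E(ℚ_p) ⊗ ℤ_p = E₁(ℚ_p) ⊗ ℤ_p` and the formal logarithm maps `E₁(ℚ_p) = Ê(pℤ_p)` isomorphically onto `pℤ_p`
(`p ≥ 3`: no torsion in `Ê(pℤ_p)`, `log` and `exp` converge on `pℤ_p`); take `Q ∈ E₁(ℚ_p)` with `log_ω(Q) = p`. (So
`min_Q ord_p log_ω(Q) = 1` and `E(ℚ_p)[p] = 0`: the S1Λ instance used at non-split `p` is `m = 0`, `Q₀ = 0`.) Why it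
might fail: only through the normalisation of `padicLogLocal` (`log(m₀•Q)/m₀` with `m₀ = [E(ℚ_p):E₁(ℚ_p)] = c_p(p+1)`,
prime to `p` — harmless). Leans on: tree `padicLogPoint` / `padicLogLocal`, `NonsplitProofs.lean`, formal group files.
[cite: SilvermanAEC2009, IV.6.4 (b), VII.2.2 and VII.6.1] [cite: SilvermanATAEC1994, IV.9.4 (Tate's algorithm, Step 2)] -/
theorem stub_nonsplitLogMinimum :
    ∀ (W : WeierstrassCurve ℚ) [W.IsElliptic] [W.IsGloballyMinimal] (p : ℕ) [Fact p.Prime],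
      5 ≤ p → W.HasMultiplicativeReductionAtPrime p → ¬ W.HasSplitMultiplicativeReductionAtPrime p →
      padicValNat p ((W.baseChange ℚ_[p]).localTamagawaNumber ℤ_[p]) = 0 ∧
      ∃ Q : (W.baseChange ℚ_[p]).toAffine.Point, padicLogLocal W p Q ≠ 0 ∧
        (padicLogLocal W p Q).valuation = 1 := by
  sorry

/-- **S3 (THE TRANSFER C⁺, XL — the door) integral exceptional-zero Perrin-Riou value, valuation form,
upper half.** For `(E,p)` in X11b with `p ≥ 5`, `ρ̄_{E,p}` onto and `p` SPLIT multiplicative, a Mordell–Weil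
generator `x̂ = P 0` and an admissible Kato class `z₀`: `#Ш_an` is a rational `q`, the bottom layer of `z₀`
has a NON-ZERO Kummer logarithm `t` (Venerucci Thm. A (2) + Thm. B at `r_an = 1`), and
`ord_p t − 2·ord_p log_ω(x̂) ≤ ord_p q + ord_p ∏ c_ℓ − 2·ord_p #E(ℚ)_tors − 1` (`−1 = ord_p(1 − p⁻¹)`).
Print: equality up to `ℚˣ` (Venerucci 2016 Thm. A `log_A(res_p ζ^{BK}) = ℓ₁ log_A²(𝐏)` [arXiv:1407.1913 p. 3];
Disegni 2020 Prop. 5). Proposed proof of the integral form = F-frame chain S3–S6 of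
`Lines/kato_bottom_layer_Fframe.md` rev 1.3 (Stage 2). Why it might fail: an uncancelled `p`-power in the
unwinding constants (Manin constant of the Shimura-curve parametrisation over `F`, Mok's `ξ(2)`, the
Petersson-measure ratio — audited to `κ = 0` in words only), or `ℓ₁`'s `ord_p(q_E)` entering with the
wrong sign. BOOKKEEPING (critic W1): the term `− 2·ord_p #E(ℚ)_tors` is `0` here (`ρ̄` onto, `p ≥ 5` ⇒ `E(ℚ)[p] = 0`)
and the door chain S1 ∧ S2 ∧ S3 is BSD-consistent — indeed BSD-TIGHT, equalities throughout — ONLY because of it;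
do not «generalise» S3 to `p ∣ #E(ℚ)_tors`. Standing hypotheses of the print support (Venerucci Thm. A):
conductor `Np`, `p > 3` split multiplicative, `A_p` irreducible, `L(A,1) = 0`; no hypothesis on `ord_p(q_A)`.
[cite: Venerucci2016, Thm. A] [cite: Disegni2020, Prop. 5] [cite: Mok2011, Thm. 1.1] [cite: PerrinRiou1993AIF, §3.3] -/
theorem stub_integralExcZeroValue :
    ∀ (W : WeierstrassCurve ℚ) [W.IsElliptic] [W.IsGloballyMinimal] (p : ℕ) [Fact p.Prime]
      [ContinuousSMul ℤ_[p] (W.tateModule p)],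
      ClassX11b W p → 5 ≤ p → Surj W p → W.HasSplitMultiplicativeReductionAtPrime p →
      ∀ (h1 : W.mordellWeilRank = 1) (P : Fin W.mordellWeilRank → W.toAffine.Point),
        W.IsMordellWeilBasis P →
      ∀ (K : ZpExtension ℚ p) (hK : K.IsCyclotomic) (γ : absoluteGaloisGroup ℚ)
        (I : IwasawaH1Data W p K γ) (z₀ : I.H), K.IsTopGenerator γ → IsAdmissibleZetaClass W p K hK I z₀ →
      ∃ (q : ℚ) (t : ℚ_[p]), shaAn W = (q : ℂ) ∧ HasLocPKummerLog W p (bottomClass W p K I z₀) t ∧ t ≠ 0 ∧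
        t.valuation - 2 * (logOmega W p (P (Fin.cast h1.symm 0))).valuation ≤
          padicValRat p q + padicValNat p W.tamagawaProduct - 2 * padicValNat p W.torsionOrder - 1 := by
  sorry

/-- **S3ns (THE TRANSFER C⁺ at a NON-SPLIT multiplicative prime; PRINT-OPEN, XL; new in rev 4, REPLACES the residual
S4′) integral Perrin-Riou value at non-split `p`, valuation form, upper half.** For `(E,p)` in X11b with `p ≥ 5`,
`ρ̄_{E,p}` onto and `p` NON-split multiplicative (multiplicative by X11b), a Mordell–Weil generator `x̂ = P 0` and an
admissible Kato class `z₀`: `#Ш_an` is a rational `q`, the bottom layer of `z₀` has a NON-ZERO Kummer logarithm `t`,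
and `ord_p t − 2·ord_p log_ω(x̂) ≤ ord_p q + ord_p ∏ c_ℓ − 2·ord_p #E(ℚ)_tors − 1`. Here `−1 = ord_p` of the local
factor of Perrin-Riou's conjectural formula `log_ω(res_p z^{Kato}) ≐ (Euler-type factor)·(L′(E,1)/Ω·Reg_∞)·log_ω(x̂)²`
at a non-split multiplicative prime (`a_p = −1`, no exceptional zero: `(1 − a_p p^{-1})`-type factor `(1 + 1/p)`, a
`p`-adic unit times `p^{-1}`) — the SAME right-hand side as S3, predicted by BSD with EQUALITY given S1Λ ∧ S2ns
(`v_min = 1`, `m = 0`: header consistency check). PRINT STATUS (searched, g39): Perrin-Riou's conjecture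
`log res_p(z_E) ≐ log(P)²` is proved for `p` SPLIT multiplicative (Venerucci 2016 Thm. A; Bertolini–Darmon family
formula), for GOOD ordinary `p` (Bertolini–Darmon–Venerucci 2022; Büyükboduk–Pollack–Sasaki) and for `p ∤ 2N`
(Burungale–Skinner–Tian–Wan 2024 Thm. 1.13, «with no ramification conditions»; their survey, arXiv:2409.01350 ll.
1017–1019, lists exactly these cases); the NON-SPLIT multiplicative case is in none of them — not even up to `ℚˣ`. The
nearest print at non-split `p` is on the HEIGHT side (Disegni 2020: rank-one `p`-adic BSD at non-split multiplicative
`p` via Disegni's `p`-adic Gross–Zagier 2017), which converts to a VALUE of `log res_p z` only through `h_p(x̂) ≠ 0`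
(catalogued barrier `PAdicHeightNondegeneracy`) — so it is NOT a substitute. Proposed proof: the F-frame chain of
`Lines/kato_bottom_layer_Fframe.md` (Stage 2) run at a non-split prime (no `𝓛`-invariant step: the two-variable
argument degenerates to the one-variable Perrin-Riou/Coleman-map computation `Col(z)(𝟙) = (1 − a_p/p)·…`, Kobayashi /
Kurihara style, with `a_p = −1`), or a direct extension of BSTW's method to `p ∥ N` non-split. Why it might fail: it is
a research statement (no print); an uncancelled `p`-power in the unwinding constants exactly as for S3; or the local
factor at non-split `p` carrying a different `p`-power than `(1 + 1/p)` in the correctly normalised formula (BSD says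
not: the chain is tight with `−1`). BOOKKEEPING (critic W1 format): `− 2·ord_p #E(ℚ)_tors = 0` here, as in S3.
Serves the J1 pairs (34 of 404: 27 at `p = 5`, 7 at `p = 7`; smallest 8670u1@5, 14560d1@5, 15390r1@5, 17955m1@7).
[cite: PerrinRiou1993AIF, §3.3] [cite: Venerucci2016, Thm. A] [cite: BertoliniDarmonVenerucci2022, Thm. A]
[cite: BurungaleSkinnerTianWan2024, Conj. 1.12 and Thm. 1.13] [cite: Disegni2020, Prop. 5] [cite: Kato2004Asterisque, Thm. 16.6] -/
theorem stub_integralNonsplitValue :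
    ∀ (W : WeierstrassCurve ℚ) [W.IsElliptic] [W.IsGloballyMinimal] (p : ℕ) [Fact p.Prime]
      [ContinuousSMul ℤ_[p] (W.tateModule p)],
      ClassX11b W p → 5 ≤ p → Surj W p → ¬ W.HasSplitMultiplicativeReductionAtPrime p →
      ∀ (h1 : W.mordellWeilRank = 1) (P : Fin W.mordellWeilRank → W.toAffine.Point),
        W.IsMordellWeilBasis P →
      ∀ (K : ZpExtension ℚ p) (hK : K.IsCyclotomic) (γ : absoluteGaloisGroup ℚ)
        (I : IwasawaH1Data W p K γ) (z₀ : I.H), K.IsTopGenerator γ → IsAdmissibleZetaClass W p K hK I z₀ →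
      ∃ (q : ℚ) (t : ℚ_[p]), shaAn W = (q : ℂ) ∧ HasLocPKummerLog W p (bottomClass W p K I z₀) t ∧ t ≠ 0 ∧
        t.valuation - 2 * (logOmega W p (P (Fin.cast h1.symm 0))).valuation ≤
          padicValRat p q + padicValNat p W.tamagawaProduct - 2 * padicValNat p W.torsionOrder - 1 := by
  sorry

/-! ## §2 The composition (kernel-checked; concludes the crux BY NAME) -/

/-- The GRADED bottom-layer chain, as pure arithmetic over `ℤ` (rev 2, kept): a bound `hB` carrying a booked defect
`d` on the left, the local minimum `hQ : vQ = 1 − c + m` and the C⁺ value `hC` give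
`sha ≤ vq + (ctot − c − d) + m − 2·vtors` — the Euler half exactly when `d` reaches `(ctot − c) + m`. -/
theorem sha_le_graded_of_chain (sha vx vQ vt vq ctot c m d vtors : ℤ)
    (hB : sha + vx - vQ + d ≤ vt - vx) (hQ : vQ = 1 - c + m)
    (hC : vt - 2 * vx ≤ vq + ctot - 2 * vtors - 1) :
    sha ≤ vq + (ctot - c - d) + m - 2 * vtors := by
  omega

/-- The split branch (rev 4 = rev 3's `sha_le_of_doorTwoGraded`, now the ONLY split branch; `d = (ctot − c) + m`,
`c = ord_p c_p`): `hB` = S1Λ, `hQ` = S2″, `hC` = S3; NO sign condition on `ctot − c`, no case split on `ctot = c`. -/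
theorem sha_le_of_doorTwoGraded (sha vx vQ vt vq ctot c m vtors : ℤ)
    (hB : sha + vx - vQ + ((ctot - c) + m) ≤ vt - vx) (hQ : vQ = 1 - c + m)
    (hC : vt - 2 * vx ≤ vq + ctot - 2 * vtors - 1) (htors : 0 ≤ vtors) :
    sha ≤ vq := by
  have h := sha_le_graded_of_chain sha vx vQ vt vq ctot c m ((ctot - c) + m) vtors hB hQ hC
  omega

/-- The non-split branch (new in rev 4; `c = 0`, `m = 0`): `hB` = S1Λ at `m = 0`, `Q₀ = 0` with its defect term
rewritten to `ctot` by S2ns (`hd`), `hQ : vQ = 1` = S2ns, `hC` = S3ns. -/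
theorem sha_le_of_nonsplitChain (sha vx vQ vt vq ctot vtors d : ℤ)
    (hB : sha + vx - vQ + d ≤ vt - vx) (hd : d = ctot) (hQ : vQ = 1)
    (hC : vt - 2 * vx ≤ vq + ctot - 2 * vtors - 1) (htors : 0 ≤ vtors) :
    sha ≤ vq := by
  omega

/-- **`EulerHalfNotRamNoInertSetAtFive` from the six stubs (rev 4).** GZK gives rank one and a Mordell–Weil generator
(tree theorem `exists_isMordellWeilBasis_holds`), Kato 12.5 (4) an admissible class (tree corollary
`exists_datum_of_hasSurjectiveModNGaloisRep`); on `p` split multiplicative: S3 the value, S2″ the Tamagawa identity and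
the graded local witnesses `(m, Q₀, Q)`, S1Λ the bound, `sha_le_of_doorTwoGraded`; on `p` non-split (multiplicative
by X11b): S3ns the value, S2ns `ord_p c_p = 0` and the witness `Q`, S1Λ at `m = 0`, `Q₀ = 0`,
`sha_le_of_nonsplitChain`. -/
theorem EulerHalfNotRamNoInertSetAtFive_of
    (hF : rank_eq_analyticRank_of_analyticRank_le_one ∧ exists_isAdmissibleZetaClass_of_imageContainsSL2)
    (hS1 : ∀ (W : WeierstrassCurve ℚ) [W.IsElliptic] [W.IsGloballyMinimal] (p : ℕ) [Fact p.Prime]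
      [ContinuousSMul ℤ_[p] (W.tateModule p)],
      5 ≤ p → Surj W p → W.analyticRank = 1 → W.HasMultiplicativeReductionAtPrime p →
      ∀ (h1 : W.mordellWeilRank = 1) (P : Fin W.mordellWeilRank → W.toAffine.Point),
        W.IsMordellWeilBasis P →
      ∀ (K : ZpExtension ℚ p) (hK : K.IsCyclotomic) (γ : absoluteGaloisGroup ℚ)
        (I : IwasawaH1Data W p K γ) (z₀ : I.H), K.IsTopGenerator γ → IsAdmissibleZetaClass W p K hK I z₀ →
      ∀ t : ℚ_[p], HasLocPKummerLog W p (bottomClass W p K I z₀) t → t ≠ 0 →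
      ∀ (m : ℕ) (Q₀ : (W.baseChange ℚ_[p]).toAffine.Point), addOrderOf Q₀ = p ^ m →
      ∀ Q : (W.baseChange ℚ_[p]).toAffine.Point, padicLogLocal W p Q ≠ 0 →
        (padicValNat p W.shaOrder : ℤ) + (logOmega W p (P (Fin.cast h1.symm 0))).valuation
            - (padicLogLocal W p Q).valuation
            + (((padicValNat p W.tamagawaProduct : ℤ)
                - padicValNat p ((W.baseChange ℚ_[p]).localTamagawaNumber ℤ_[p])) + m) ≤
          t.valuation - (logOmega W p (P (Fin.cast h1.symm 0))).valuation)
    (hS2 : ∀ (W : WeierstrassCurve ℚ) [W.IsElliptic] [W.IsGloballyMinimal] (p : ℕ) [Fact p.Prime],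
      5 ≤ p → W.HasSplitMultiplicativeReductionAtPrime p →
      (W.baseChange ℚ_[p]).localTamagawaNumber ℤ_[p] = padicValInt p W.minimalDiscriminantInt ∧
      ∃ (m : ℕ) (Q₀ Q : (W.baseChange ℚ_[p]).toAffine.Point), addOrderOf Q₀ = p ^ m ∧
        padicLogLocal W p Q ≠ 0 ∧
        (padicLogLocal W p Q).valuation =
          1 - (padicValNat p (padicValInt p W.minimalDiscriminantInt) : ℤ) + m)
    (hS2n : ∀ (W : WeierstrassCurve ℚ) [W.IsElliptic] [W.IsGloballyMinimal] (p : ℕ) [Fact p.Prime],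
      5 ≤ p → W.HasMultiplicativeReductionAtPrime p → ¬ W.HasSplitMultiplicativeReductionAtPrime p →
      padicValNat p ((W.baseChange ℚ_[p]).localTamagawaNumber ℤ_[p]) = 0 ∧
      ∃ Q : (W.baseChange ℚ_[p]).toAffine.Point, padicLogLocal W p Q ≠ 0 ∧
        (padicLogLocal W p Q).valuation = 1)
    (hS3 : ∀ (W : WeierstrassCurve ℚ) [W.IsElliptic] [W.IsGloballyMinimal] (p : ℕ) [Fact p.Prime]
      [ContinuousSMul ℤ_[p] (W.tateModule p)],
      ClassX11b W p → 5 ≤ p → Surj W p → W.HasSplitMultiplicativeReductionAtPrime p →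
      ∀ (h1 : W.mordellWeilRank = 1) (P : Fin W.mordellWeilRank → W.toAffine.Point),
        W.IsMordellWeilBasis P →
      ∀ (K : ZpExtension ℚ p) (hK : K.IsCyclotomic) (γ : absoluteGaloisGroup ℚ)
        (I : IwasawaH1Data W p K γ) (z₀ : I.H), K.IsTopGenerator γ → IsAdmissibleZetaClass W p K hK I z₀ →
      ∃ (q : ℚ) (t : ℚ_[p]), shaAn W = (q : ℂ) ∧ HasLocPKummerLog W p (bottomClass W p K I z₀) t ∧ t ≠ 0 ∧
        t.valuation - 2 * (logOmega W p (P (Fin.cast h1.symm 0))).valuation ≤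
          padicValRat p q + padicValNat p W.tamagawaProduct - 2 * padicValNat p W.torsionOrder - 1)
    (hS3n : ∀ (W : WeierstrassCurve ℚ) [W.IsElliptic] [W.IsGloballyMinimal] (p : ℕ) [Fact p.Prime]
      [ContinuousSMul ℤ_[p] (W.tateModule p)],
      ClassX11b W p → 5 ≤ p → Surj W p → ¬ W.HasSplitMultiplicativeReductionAtPrime p →
      ∀ (h1 : W.mordellWeilRank = 1) (P : Fin W.mordellWeilRank → W.toAffine.Point),
        W.IsMordellWeilBasis P →
      ∀ (K : ZpExtension ℚ p) (hK : K.IsCyclotomic) (γ : absoluteGaloisGroup ℚ)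
        (I : IwasawaH1Data W p K γ) (z₀ : I.H), K.IsTopGenerator γ → IsAdmissibleZetaClass W p K hK I z₀ →
      ∃ (q : ℚ) (t : ℚ_[p]), shaAn W = (q : ℂ) ∧ HasLocPKummerLog W p (bottomClass W p K I z₀) t ∧ t ≠ 0 ∧
        t.valuation - 2 * (logOmega W p (P (Fin.cast h1.symm 0))).valuation ≤
          padicValRat p q + padicValNat p W.tamagawaProduct - 2 * padicValNat p W.torsionOrder - 1) :
    EulerHalfNotRamNoInertSetAtFive := by
  intro W _ _ p _ hX h5 hSurj hnRam hTam hNoS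
  haveI : ContinuousSMul ℤ_[p] (W.tateModule p) := TateModule.continuousSMul_padicInt
  have hr1 : W.analyticRank = 1 := hX.1
  have hmult : W.HasMultiplicativeReductionAtPrime p := hX.2.2.1
  have hmw : W.mordellWeilRank = 1 := by
    have h := (hF.1 W (le_of_eq hr1)).1
    omega
  obtain ⟨P, hP⟩ := W.exists_isMordellWeilBasis_holds
  obtain ⟨K, hK, γ, I, z₀, hγ, hz⟩ := hF.2.exists_datum_of_hasSurjectiveModNGaloisRep W p h5 hSurj
  by_cases hsplit : W.HasSplitMultiplicativeReductionAtPrime p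
  · obtain ⟨q, t, hq, ht, ht0, hC⟩ := hS3 W p hX h5 hSurj hsplit hmw P hP K hK γ I z₀ hγ hz
    obtain ⟨hcp, m, Q₀, Q, hQ₀, hQ0, hQv⟩ := hS2 W p h5 hsplit
    refine ⟨q, hq, ?_⟩
    have hB := hS1 W p h5 hSurj hr1 hmult hmw P hP K hK γ I z₀ hγ hz t ht ht0 m Q₀ hQ₀ Q hQ0
    rw [hcp] at hB
    exact sha_le_of_doorTwoGraded _ _ _ _ _ _ _ _ _ hB hQv hC (by positivity)
  · obtain ⟨q, t, hq, ht, ht0, hC⟩ := hS3n W p hX h5 hSurj hsplit hmw P hP K hK γ I z₀ hγ hz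
    obtain ⟨hc0, Q, hQ0, hQv⟩ := hS2n W p h5 hmult hsplit
    refine ⟨q, hq, ?_⟩
    have hB := hS1 W p h5 hSurj hr1 hmult hmw P hP K hK γ I z₀ hγ hz t ht ht0 0 0 (by simp) Q hQ0
    exact sha_le_of_nonsplitChain _ _ _ _ _ _ _ _ hB (by rw [hc0]; simp) hQv hC (by positivity)

/-- The same composition keyed by the stub NAMES (so that a skeleton registration — by the LEAD / pen only,
W-79 — would record exactly these six signatures). -/
theorem EulerHalfNotRamNoInertSetAtFive_of_stubs : EulerHalfNotRamNoInertSetAtFive :=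
  EulerHalfNotRamNoInertSetAtFive_of stub_printedFactsHeld stub_katoLambdaLogBoundTamagawa
    stub_tateUniformisationLogMinimumTamagawa stub_nonsplitLogMinimum stub_integralExcZeroValue
    stub_integralNonsplitValue

end Summit.BirchSwinnertonDyer.BirchSwinnertonDyer.Cruxes.EulerHalfNotRamNoInertSetAtFive.KatoFframe

end
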